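import Summits.BirchSwinnertonDyer.Rank1Residual.Additive.X4RankOneKimPartialShape
import Summits.BirchSwinnertonDyer.Rank1Residual.X4.KimShaLength
import Summits.BirchSwinnertonDyer.Rank1Residual.Additive.X4KimLargeImagePrimary
import HarnessLib

/-!
# X4 ∧ `r_an = 1`: the IMPLICATION LATTICE link between cc-typer-1's rank-agnostic core
# `X4.KimShaLengthAt W p f` (Kim Thm. 1.9 (6) verbatim in `∂`-currency) and the rank-one `∂`-clause
# `KimRankOnePartialAt W p` of T-a2r1b — anti-drift (lead R3-21 (b)), theorems only
# (cell `b2b-bsdres`, team n1011, sub-target T-a2r1b; sibling of `Additive/X4RankOneKimPartialShape.lean`)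

HONEST FRAMING (cell `b2b-bsdres`, run/shared/lean/b2b/bsd-rank1-residual/, verbatim in every
file): the goal of the cell is to DELETE the COMBINATION-SHAPED residual classes of the
Birch–Swinnerton-Dyer formula for ALL analytic-rank `≤ 1` elliptic curves over `ℚ` — "full BSD
formula for every rank `≤ 1` curve in class `C`" assembled STRICTLY from published theorems — so
that the rank-`≤ 1` remainder becomes exactly the CONSTRUCTION-SHAPED classes, which are TYPED
(missing-input `Prop`s), NOT attempted. This is not "finishing BSD". Team n1011: prove what is
provable now; shrink each hard class to its core with data; no claim beyond stated classes;
research routes; census output = EVIDENCE / conjecture items, never a Literature fact. Nothing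
here is booked; no mark moves. Theorems only (no definition, no named fact).

## What this file proves (lead R3-21 (b): "NO NEW Kim-at-3 `@[conjecture]` Prop lands without …
the bridge theorem(s) to at least one [existing Prop]"; p03's §(η) implication lattice)

cc-typer-1 typed the VERBATIM CORE of Kim's clause (6) as the bare per-`(W, p, f)` predicate
`X4.KimShaLengthAt W p f := ∀ r, ord(δ̃) = r → ∃ d, ∂^{(∞)}(δ̃) = d ∧ ∂^{(r)}(δ̃) = ord_p #Ш(p) + d`
(`X4/KimShaLength.lean`, rank-agnostic, no binders). T-a2r1b's `KimRankOnePartialAt W p`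
(p251071) is the rank-one reading WITH Kim's binders: `… → L(E,1) = 0 → r_an = 1 → … →
∂^{(1)} ≠ ∞ → length + ∂^{(∞)} = ∂^{(1)}`. This file proves the link:
* `kuriharaDivIndex_one_eq_top_of_entireLFunction_one_eq_zero` — `L(E,1) = 0 ⟹ δ̃_1 = [0]⁺_f = 0
  ⟹ kuriharaDivIndex W p f 1 = ⊤` (composing p09's `ratPlusSymbol_zero_eq_zero_of_entireLFunction_one_eq_zero`
  and `kuriharaDivIndex_one_eq_top_of_ratPlusSymbol_zero_eq_zero`, `X4KimLargeImagePrimary.lean` — reused, not re-declared);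
* `kuriharaVanishingOrder_eq_one` — `kuriharaDivIndex 1 = ⊤ ∧ ∂^{(1)} ≠ ⊤ ⟹ ord(δ̃) = 1`;
* **`kimRankOnePartialAt_of_kimShaLengthAt`** — `(∀ D, X4.KimShaLengthAt W p D.f) ⟹ KimRankOnePartialAt W p`:
  the rank-one `∂`-clause IS the `r = 1` instance of cc-typer-1's core, read under Kim's binders
  (of which only `L(E,1) = 0`, the datum `D` and `∂^{(1)} ≠ ⊤` are used; the others are carried).
  Hence `KimThreeRankOnePartial` / `X4SharpThreeKimRankOnePartial` ⟸ "clause (6) core at `3` for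
  every datum" (`kimThreeRankOnePartial_of_kimShaLengthAt`), so the two `∂`-currency channels
  cannot drift, and every TAM-row consumer of `X4RankOneKimTamagawaDefect.lean` is ALSO a consumer
  of cc-typer-1's core + p12's `KimTamagawaDefectGeAt`.

References: Kim 2026 [Kim2022StructureSelmer] Thm. 1.9 (6), §1.4.3–1.4.4, §1.5.1; cells/n1011/PLAN.md
R3-21 (b); KIM-AT-3-ANATOMY §(η).
-/

noncomputable section

open scoped Classical MatrixGroups ModularForm

open CongruenceSubgroup WeierstrassCurve Literature.NumberTheory.EllipticCurves
  Literature.NumberTheory.EllipticCurves.ModularForms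
  Literature.NumberTheory.EllipticCurves.Rank1Residual
  Literature.NumberTheory.EllipticCurves.Rank1Residual.Typed

open Literature.NumberTheory.DiophantineGeometry.Dioph (ratModP)

namespace Summit.BirchSwinnertonDyer.Rank1Residual.Additive

section VanishingOrder

variable (W : WeierstrassCurve ℚ) [W.IsElliptic] [W.IsGloballyMinimal] (p : ℕ) {N : ℕ} [NeZero N]
  (f : CuspForm (Gamma0 N) 2)

omit [W.IsGloballyMinimal] in
/-- **In analytic rank `≥ 1` the level-`1` Kurihara number vanishes identically**:
`L(E,1) = 0 ⟹ kuriharaDivIndex W p f 1 = ⊤` for the newform `f` of `W`.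
[cite: Kim2022StructureSelmer, §1.4.3 (PDF p. 7)] -/
theorem kuriharaDivIndex_one_eq_top_of_entireLFunction_one_eq_zero [W.IsGloballyMinimal]
    (hf : IsNewformOf W f) (hL : W.entireLFunction 1 = 0) : kuriharaDivIndex W p f 1 = ⊤ :=
  kuriharaDivIndex_one_eq_top_of_ratPlusSymbol_zero_eq_zero W p
    (ratPlusSymbol_zero_eq_zero_of_entireLFunction_one_eq_zero W hf hL)

omit [W.IsElliptic] [NeZero N] in
/-- **`ord(δ̃) = 1`** when the level-`1` number vanishes (`kuriharaDivIndex 1 = ⊤`) and some cyclic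
prime-level number does not (`∂^{(1)} ≠ ⊤`): the minimum of `ν(n)` over the cyclic levels with a
non-zero `δ̃_n` is attained at a prime and not at `n = 1`. [cite: Kim2022StructureSelmer, §1.4.4 (PDF p. 7)] -/
theorem kuriharaVanishingOrder_eq_one (h1 : kuriharaDivIndex W p f 1 = ⊤)
    (hne : kuriharaPartial W p f 1 ≠ ⊤) : kuriharaVanishingOrder W p f = 1 := by
  -- upper bound: some cyclic level with one prime factor carries a finite index
  have hex : ∃ n : ℕ, IsCyclicKolyvaginLevel W p n ∧ n.primeFactors.card = 1 ∧
      kuriharaDivIndex W p f n < ⊤ := by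
    by_contra hcon
    simp only [not_exists, not_and, not_lt] at hcon
    apply hne
    rw [kuriharaPartial_def]
    exact le_antisymm le_top (le_iInf fun n => le_iInf fun hn => le_iInf fun hcard => hcon n hn hcard)
  obtain ⟨n, hn, hcard, hlt⟩ := hex
  refine le_antisymm ?_ ?_
  · unfold kuriharaVanishingOrder
    refine iInf_le_of_le n (iInf_le_of_le hn (iInf_le_of_le hlt ?_))
    exact_mod_cast hcard.le
  · unfold kuriharaVanishingOrder
    refine le_iInf fun m => le_iInf fun hm => le_iInf fun hmlt => ?_
    -- `m ≠ 1` (the level-`1` index is `⊤`), `m ≠ 0` (Kolyvagin products are non-zero), so `ν(m) ≥ 1`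
    have hm1 : m ≠ 1 := by
      rintro rfl
      rw [h1] at hmlt
      exact lt_irrefl _ hmlt
    have hm0 : m ≠ 0 := hm.1.ne_zero
    have : 1 ≤ m.primeFactors.card := by
      rw [Nat.one_le_iff_ne_zero, Ne, Finset.card_eq_zero, Nat.primeFactors_eq_empty]
      omega
    exact_mod_cast this

end VanishingOrder

/-! ## The bridge: cc-typer-1's core ⟹ the rank-one `∂`-clause -/

section Bridge

variable (W : WeierstrassCurve ℚ) [W.IsElliptic] [W.IsGloballyMinimal] (p : ℕ) [Fact p.Prime]

/-- **`X4.KimShaLengthAt` (clause (6) core, every datum) ⟹ `KimRankOnePartialAt`**: under the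
rank-one binders, `L(E,1) = 0` makes `δ̃_1 = 0` and the hypothesis `∂^{(1)} ≠ ⊤` makes `ord(δ̃) = 1`
(`kuriharaVanishingOrder_eq_one`), so the core at `r = 1` returns `d = ∂^{(∞)} ∈ ℕ` with
`∂^{(1)} = ord_p #Ш(p) + d` — the conclusion of the rank-one clause. The datum `D` supplies the
newform (`D.isNewformOf`); the tower, `r_an`, `Finite Ш`, Manin and period binders are carried, not
used (they are part of Kim's hypotheses for the core to HOLD, not of this formal implication).
Anti-drift (lead R3-21 (b)). [cite: Kim2022StructureSelmer, Thm. 1.9 (6), §1.4.3–1.4.4 (PDF pp. 7–8)] -/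
theorem kimRankOnePartialAt_of_kimShaLengthAt
    (hcore : ∀ {N : ℕ} [NeZero N] (D : ModularParametrizationData W N), X4.KimShaLengthAt W p D.f) :
    KimRankOnePartialAt W p := by
  intro _ _ hL _ _ N _ D _ _ hne
  have h1 : kuriharaDivIndex W p D.f 1 = ⊤ :=
    kuriharaDivIndex_one_eq_top_of_entireLFunction_one_eq_zero W p D.f D.isNewformOf hL
  have hord : kuriharaVanishingOrder W p D.f = 1 := kuriharaVanishingOrder_eq_one W p D.f h1 hne
  obtain ⟨d, hd, hr⟩ := hcore D 1 hord
  rw [hd, hr]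
  push_cast
  rfl

/-- **Every-curve form at `3`**: "clause (6) core at `3` for every globally minimal elliptic `W` and
every datum" ⟹ `KimThreeRankOnePartial`. Anti-drift. [cite: Kim2022StructureSelmer, Thm. 1.9 (6) (PDF p. 8)] -/
theorem kimThreeRankOnePartial_of_kimShaLengthAt
    (hcore : ∀ (W : WeierstrassCurve ℚ) [W.IsElliptic] [W.IsGloballyMinimal] {N : ℕ} [NeZero N]
      (D : ModularParametrizationData W N), X4.KimShaLengthAt W 3 D.f) :
    KimThreeRankOnePartial :=
  fun W _ _ => kimRankOnePartialAt_of_kimShaLengthAt W 3 (fun D => hcore W D)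

/-- **Additive form at `3`**: the same core restricted to `Addv W 3` ⟹ `X4SharpThreeKimRankOnePartial`
(so the TAM-row consumers of `X4RankOneKimTamagawaDefect.lean` are consumers of cc-typer-1's core +
p12's `KimTamagawaDefectGeAt`). Anti-drift. [cite: Kim2022StructureSelmer, Thm. 1.9 (6) (PDF p. 8)] -/
theorem x4SharpThreeKimRankOnePartial_of_kimShaLengthAt
    (hcore : ∀ (W : WeierstrassCurve ℚ) [W.IsElliptic] [W.IsGloballyMinimal], Addv W 3 →
      ∀ {N : ℕ} [NeZero N] (D : ModularParametrizationData W N), X4.KimShaLengthAt W 3 D.f) :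
    X4SharpThreeKimRankOnePartial :=
  fun W _ _ hadd => kimRankOnePartialAt_of_kimShaLengthAt W 3 (fun D => hcore W hadd D)

end Bridge

end Summit.BirchSwinnertonDyer.Rank1Residual.Additive

end
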